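import Mathlib.RingTheory.Etale.Pi
import Mathlib.LinearAlgebra.Matrix.Invertible
import Literature.AlgebraicGeometry.ShimuraVarieties.UnitaryBallQuotientDatum
import Literature.RepresentationTheory.Liu2021.LocalOscillatorDatumOfCentralChar
import HarnessLib

/-!
# Liu 2021, App. D §D.1 — the STANDING DATA of the local oscillator representation, hardened, and the
# split place `E = F × F`: `U(V) = GL_n(F)`, `E¹ = Fˣ`, "the first component of `χ̌` is `χ`"

Yifeng Liu, *Fourier–Jacobi cycles and arithmetic relative trace formula* (with an appendix by Chao Li and
Yihang Zhu), Camb. J. Math. **9** (2021) = arXiv:2102.11518 [Liu2021], App. D §D.1 (arXiv §10.1, p. 56; held text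
`paper:arxiv-2102.11518`, chunk p0056).

WHY THIS FILE.  The record `Literature.RepresentationTheory.Liu2021.LocalOscillatorDatum.IrreducibleAdmissible`
(`LocalOscillatorRepresentation.lean`; [Liu2021, App. D Lemma D.1 = arXiv Lemma 10.1], registry row N-f1 of the
pub-hodgecm cells) is a `Prop` over an ABSTRACT datum `LocalOscillatorDatum G Z V W`: the group `G`, its central
subgroup `Z` and the embedding `zeta : Z →* G` are bare carriers, and print's standing hypotheses — [p0056 L8]
"Let `F` be a local field whose characteristic is not `2`. Let `E` be an étale `F`-algebra of rank `2`. Denote by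
`c` the unique nontrivial involution on `E` that fixes `F`, and put `E⁻ := {x ∈ E | x + xᶜ = 0}` and
`E¹ := {x ∈ E | x xᶜ = 1}`. Let `V, ( , )_V` be a (non-degenerate) hermitian space over `E` (with respect to `c`)
of rank `n ≥ 2`." — are only OBJECT-MATCH DUTIES of the citing instance (items (a), (c), (e) of that file's module
docstring §3).  This file HARDENS those binders into data:

* §1 `OscillatorStandingData F E n`: an `F`-algebra involution `conj` of `E` (involutive, `≠ 1`), a Gram matrix
  `gram ∈ M_n(E)` which is `conj`-HERMITIAN with UNIT DETERMINANT (print's "(non-degenerate) hermitian space …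
  of rank `n`", in coordinates `V = Eⁿ`, `(u, v)_V = Σ conj(uᵢ) gramᵢⱼ vⱼ` = the tree's
  `ShimuraVarieties.hermForm`), `ringChar F ≠ 2`, `Algebra.FormallyEtale F E` with `finrank F E = 2` (print's
  "étale `F`-algebra of rank `2`": for a finite algebra over a field, formally étale = étale = a finite product
  of separable extensions, Mathlib `Algebra.FormallyEtale.iff_exists_algEquiv_prod`), and `2 ≤ n`.  From it we
  BUILD print's groups: `S.U = U(V)(F)`, the tree's `ShimuraVarieties.unitaryGroup conj gram ≤ GL_n(E)` (REUSED,
  not re-declared); `S.normOne = E¹ ≤ Eˣ`; the scalar embedding `S.scalar : E¹ →* U(V)`, PROVED central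
  (`scalar_mem_center`); and print's twisted character `χ̌(x) = χ(x / xᶜ)` [p0056 L18] (`S.check χ`).
* §2 `S.datum ω χ`: the Liu datum of the EXISTING record assembled over these honest carriers (via the companion
  constructor `LocalOscillatorDatum.ofCentralChar`): `G := S.U` with the topology it inherits from `E`
  (`GL_n(E) ⊆ M_n(E) × M_n(E)ᵐᵒᵖ`), `Z := S.normOne`, `zeta := S.scalar`, `rank := n`, and the maximal
  `χ`-quotient of item (d) is now the CONSTRUCTED `CentralCharacterQuotient.quotRep`.  What REMAINS an
  object-match duty is item (b) of the record — `ω = ω(μ, ε) = ω(ε) ∘ ι_μ` (the Weil representation pulled back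
  along the [HKS] splitting) — together with the continuity half of (c) (`χ` continuous) and the local-field half
  of (a) (`F` a NON-ARCHIMEDEAN LOCAL field, Mathlib `IsNonarchimedeanLocalField F`, `E` carrying its module
  topology).  NO new `Prop` record is introduced: the cited statement about `S.datum ω χ` is the existing
  `LocalOscillatorDatum.IrreducibleAdmissible`, and `irreducibleAdmissible_datum_iff` unfolds it.
* §3 THE SPLIT PLACE `E = F × F` (first paragraph of Liu's proof, [p0056 L32]: "We consider first the case where
  `E = F × F`. We identify `U(V)` with `GL_n(F)` and `E⁻` with `F` through the first factor; and write
  `μ = ν ⊠ ν⁻¹`. Note that the first component of `χ̌` is simply `χ`."), PROVED in the kernel: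
  `splitData` (the standing data ARE satisfied by `F × F` with the swap involution — `FormallyEtale`,
  `finrank = 2` — for any `H₁ ∈ GL_n(F)`, Gram matrix `(H₁, H₁ᵀ)`); `normOneEquiv : E¹ ≃* Fˣ` and
  `unitaryEquiv : U(V) ≃* GL_n(F)` through the first factor; `unitaryEquiv_scalar` (the centre `E¹` goes to the
  scalars `Fˣ ⊂ GL_n(F)`); `check_inl : χ̌(a, 1) = χ(a)`; `not_isField : ¬ IsField (F × F)` (bullet (1)'s
  exceptional case "E is a field" never occurs at a split place).

NOT HERE (reported to the cell as `AUDIT B06-4: HARDEN-only`): the REST of the split-case proof — "`ω(μ,ε,χ)` is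
isomorphic to the unitary induction from `P_{n-1,1}(F)` to `GL_n(F)` of the (unitary) character
`(ν∘det) ⊠ χν^{1-n}` … See for example [GR90] 2.6. The lemma follows from such description." — needs a
CONSTRUCTED split-place `ω(μ, ε)` on `𝒮(Fⁿ)` (the tree has the Siegel-Levi operators
`HeisenbergGroup.leviOp`, not the normalised representation of `GL_n(F)`), smooth parabolic induction for
`GL_n(F)` and the irreducibility of unitary parabolic induction (Bernstein–Zelevinsky); none is in Mathlib or the
tree.  Nothing in this file is asserted without proof; there is no hypothesis record.

## References

* [Liu2021] Y. Liu, Camb. J. Math. 9 (2021) = arXiv:2102.11518, App. D §D.1: standing hypotheses and Steps 1–3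
  (arXiv p. 56 L8–L18), Lemma D.1 (= arXiv Lemma 10.1, L20–L29), proof, split case (L32).
* [GelbartRogawski1990] S. Gelbart, J. Rogawski, *Exceptional representations and Shimura's integral for the local
  unitary group U(3)*, Piatetski-Shapiro Festschrift I (1990), §2.6 — Liu's reference for the split case (quoted,
  not used).
-/

noncomputable section

open Matrix

namespace Literature.RepresentationTheory.Liu2021

open Literature.AlgebraicGeometry.ShimuraVarieties (unitaryGroup mem_unitaryGroup_iff hermForm)

universe uF uE

/-! ## §1 The standing data of [Liu2021, App. D §D.1] and the groups `U(V)`, `E¹` built from them -/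

/-- **Standing data of [Liu2021, App. D §D.1]** (arXiv p. 56 L8), HARDENED into data over Mathlib carriers, in
coordinates `V = Eⁿ`: `conj` = print's `c`, "the unique nontrivial involution on `E` that fixes `F`" (an
`F`-algebra automorphism, involutive, `≠ 1`); `gram` = the Gram matrix of "a (non-degenerate) hermitian space over
`E` (with respect to `c`) of rank `n`" (`conj`-hermitian: `(gram.map conj)ᵀ = gram`; non-degenerate:
`IsUnit gram.det`); `ringChar_ne_two` = "a local field whose characteristic is not `2`"; `formallyEtale`,
`finrank_eq_two` = "an étale `F`-algebra of rank `2`"; `two_le` = "`n ≥ 2`".  (That `F` is a non-archimedean LOCAL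
field and `E` carries its module topology stays with the citing instance, see §2.)
[cite: Liu2021, App. D §D.1, arXiv:2102.11518 p. 56 L8] -/
structure OscillatorStandingData (F : Type uF) (E : Type uE) [Field F] [CommRing E] [Algebra F E] (n : ℕ) where
  /-- print's `c`: the nontrivial involution of `E/F`. -/
  conj : E ≃ₐ[F] E
  /-- `c` is an involution. -/
  conj_conj : ∀ x, conj (conj x) = x
  /-- `c` is nontrivial. -/
  conj_ne_refl : conj ≠ AlgEquiv.refl
  /-- the Gram matrix of `( , )_V` in coordinates `V = Eⁿ`. -/
  gram : Matrix (Fin n) (Fin n) E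
  /-- `( , )_V` is hermitian with respect to `c`. -/
  gram_hermitian : (gram.map conj)ᵀ = gram
  /-- `( , )_V` is non-degenerate. -/
  isUnit_det_gram : IsUnit gram.det
  /-- "whose characteristic is not `2`". -/
  ringChar_ne_two : ringChar F ≠ 2
  /-- "étale `F`-algebra …" -/
  formallyEtale : Algebra.FormallyEtale F E
  /-- "… of rank `2`". -/
  finrank_eq_two : Module.finrank F E = 2
  /-- "of rank `n ≥ 2`". -/
  two_le : 2 ≤ n

namespace OscillatorStandingData

variable {F : Type uF} {E : Type uE} [Field F] [CommRing E] [Algebra F E] {n : ℕ}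
variable (S : OscillatorStandingData F E n)

/-- `c` as a ring homomorphism. [folklore] -/
def σ : E →+* E := S.conj.toRingEquiv.toRingHom

/-- `S.σ` is print's `c`. [cite: Liu2021, App. D §D.1, arXiv:2102.11518 p. 56 L8] -/
@[simp] theorem σ_apply (x : E) : S.σ x = S.conj x := rfl

/-- `c ∘ c = id` on units. [cite: Liu2021, App. D §D.1, arXiv:2102.11518 p. 56 L8] -/
@[simp] theorem map_σ_map_σ (x : Eˣ) : Units.map (S.σ : E →* E) (Units.map (S.σ : E →* E) x) = x :=
  Units.ext (S.conj_conj x)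

/-- `( , )_V` in coordinates: the tree's `hermForm` of `(c, gram)`, `(u, v)_V = Σ c(uᵢ) gramᵢⱼ vⱼ`.
[cite: Liu2021, App. D §D.1, arXiv p. 56 L8] -/
def form (u v : Fin n → E) : E := hermForm S.σ S.gram u v

/-- **`U(V)(F)`** — the unitary group of the hermitian space `(Eⁿ, gram)`: the tree's
`ShimuraVarieties.unitaryGroup c gram ≤ GL_n(E)`, `{g | (gᶜ)ᵀ · gram · g = gram}`.
[cite: Liu2021, App. D §D.1, arXiv p. 56 L10] -/
def U : Subgroup (GL (Fin n) E) := unitaryGroup S.σ S.gram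

/-- membership in `U(V)`: `(gᶜ)ᵀ · gram · g = gram`. [cite: Liu2021, App. D §D.1, arXiv:2102.11518 p. 56 L8–L10] -/
theorem mem_U_iff (g : GL (Fin n) E) :
    g ∈ S.U ↔ ((g : Matrix (Fin n) (Fin n) E).map S.conj)ᵀ * S.gram * (g : Matrix (Fin n) (Fin n) E) = S.gram :=
  mem_unitaryGroup_iff

/-- **`E¹ = {x ∈ E | x xᶜ = 1}`** as a subgroup of `Eˣ` (every such `x` is a unit, with inverse `xᶜ`): the kernel
of `x ↦ x · xᶜ`. [cite: Liu2021, App. D §D.1, arXiv p. 56 L8] -/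
def normOne : Subgroup Eˣ := (MonoidHom.id Eˣ * Units.map (S.σ : E →* E)).ker

/-- membership in `E¹`, on units: `x · xᶜ = 1`. [cite: Liu2021, App. D §D.1, arXiv:2102.11518 p. 56 L8] -/
theorem mem_normOne_iff (x : Eˣ) : x ∈ S.normOne ↔ x * Units.map (S.σ : E →* E) x = 1 := Iff.rfl

/-- membership in `E¹` on the level of `E`: `x xᶜ = 1`. [cite: Liu2021, App. D §D.1, arXiv p. 56 L8] -/
theorem mem_normOne_iff' (x : Eˣ) : x ∈ S.normOne ↔ (x : E) * S.conj x = 1 := by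
  rw [mem_normOne_iff, Units.ext_iff, Units.val_mul, Units.coe_map, Units.val_one]
  rfl

/-- Every `x ∈ E` with `x xᶜ = 1` is a unit lying in `E¹`. [cite: Liu2021, App. D §D.1, arXiv:2102.11518 p. 56 L8] -/
theorem mem_normOne_of_mul_conj_eq_one {x : E} (hx : x * S.conj x = 1) :
    ∃ u : Eˣ, (u : E) = x ∧ u ∈ S.normOne :=
  ⟨Units.mkOfMulEqOne x (S.conj x) hx, rfl, (S.mem_normOne_iff' _).2 hx⟩

/-- the scalar matrices `Eˣ → GL_n(E)`, `x ↦ x · 1`. [folklore] -/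
def unitScalar (n : ℕ) : Eˣ →* GL (Fin n) E :=
  Units.map (Matrix.scalar (Fin n) : E →+* Matrix (Fin n) (Fin n) E).toMonoidHom

/-- the matrix of the scalar `x · 1`. [cite: Liu2021, App. D §D.1 Step 3, arXiv:2102.11518 p. 56 L16] -/
@[simp] theorem coe_unitScalar (x : Eˣ) :
    ((unitScalar n x : GL (Fin n) E) : Matrix (Fin n) (Fin n) E) = Matrix.scalar (Fin n) (x : E) := rfl

/-- A scalar `x ∈ E¹` is an isometry of `( , )_V`: `(x·1)ᶜᵀ gram (x·1) = xᶜ x · gram = gram`.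
[cite: Liu2021, App. D §D.1 Step 3, arXiv:2102.11518 p. 56 L16] -/
theorem unitScalar_mem_U {x : Eˣ} (hx : x ∈ S.normOne) : unitScalar n x ∈ S.U := by
  rw [mem_U_iff, coe_unitScalar]
  have hx' : S.conj x * (x : E) = 1 := by rw [mul_comm]; exact (S.mem_normOne_iff' x).1 hx
  ext i j
  simp only [Matrix.scalar_apply, diagonal_map (map_zero _), diagonal_transpose, diagonal_mul, mul_diagonal]
  calc S.conj (x : E) * S.gram i j * (x : E) = (S.conj x * (x : E)) * S.gram i j := by ring
    _ = S.gram i j := by rw [hx', one_mul]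

/-- **The centre `E¹ ↪ U(V)`** (scalars), print's "central character" source [p0056 L16]: `x ↦ x · 1`.
[cite: Liu2021, App. D §D.1 Step 3, arXiv p. 56 L16] -/
def scalar : S.normOne →* S.U :=
  ((unitScalar n).comp S.normOne.subtype).codRestrict S.U fun x => S.unitScalar_mem_U x.2

/-- the matrix of the central element `x ∈ E¹ ↪ U(V)` is `x · 1`. [cite: Liu2021, App. D §D.1 Step 3, arXiv:2102.11518 p. 56 L16] -/
@[simp] theorem coe_scalar (x : S.normOne) :
    (((S.scalar x : S.U) : GL (Fin n) E) : Matrix (Fin n) (Fin n) E) = Matrix.scalar (Fin n) ((x : Eˣ) : E) :=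
  rfl

/-- `E¹` IS central in `U(V)` (scalar matrices commute with everything). [cite: Liu2021, App. D §D.1 Step 3, arXiv:2102.11518 p. 56 L16] -/
theorem scalar_mem_center (x : S.normOne) : S.scalar x ∈ Subgroup.center S.U := by
  rw [Subgroup.mem_center_iff]
  intro g
  apply Subtype.ext
  apply Units.ext
  change (g : GL (Fin n) E).1 * Matrix.scalar (Fin n) ((x : Eˣ) : E) =
    Matrix.scalar (Fin n) ((x : Eˣ) : E) * (g : GL (Fin n) E).1
  exact ((scalar_commute _ (fun r' => Commute.all _ r') _).eq).symm

/-- `x ↦ x / xᶜ : Eˣ → E¹` (so that `χ̌ = χ ∘ (x ↦ x/xᶜ)`). [cite: Liu2021, App. D §D.1, arXiv p. 56 L18] -/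
def divConj : Eˣ →* S.normOne :=
  (MonoidHom.id Eˣ / Units.map (S.σ : E →* E)).codRestrict S.normOne fun x => by
    rw [mem_normOne_iff, MonoidHom.div_apply, MonoidHom.id_apply, map_div, map_σ_map_σ, div_eq_mul_inv,
      div_eq_mul_inv, mul_assoc, inv_mul_cancel_left, mul_inv_cancel]

/-- `divConj x = x / xᶜ` in `Eˣ`. [cite: Liu2021, App. D §D.1, arXiv:2102.11518 p. 56 L18] -/
@[simp] theorem coe_divConj (x : Eˣ) : ((S.divConj x : S.normOne) : Eˣ) = x / Units.map (S.σ : E →* E) x :=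
  rfl

/-- **`χ̌`**: "For `χ` in Step 3, we define a character `χ̌` of `E^×` via the formula `χ̌(x) = χ(x/xᶜ)`."
[cite: Liu2021, App. D §D.1, arXiv p. 56 L18] -/
def check (χ : S.normOne →* ℂˣ) : Eˣ →* ℂˣ := χ.comp S.divConj

/-- `χ̌(x) = χ(x / xᶜ)`. [cite: Liu2021, App. D §D.1, arXiv:2102.11518 p. 56 L18] -/
theorem check_apply (χ : S.normOne →* ℂˣ) (x : Eˣ) : S.check χ x = χ (S.divConj x) := rfl

/-- On `E¹` itself `x/xᶜ = x²`, so `χ̌|_{E¹} = χ²`. [cite: Liu2021, App. D §D.1, arXiv:2102.11518 p. 56 L18] -/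
theorem divConj_coe (x : S.normOne) : S.divConj (x : Eˣ) = x * x := by
  apply Subtype.ext
  have hx : (x : Eˣ) * Units.map (S.σ : E →* E) x = 1 := x.2
  have hinv : (Units.map (S.σ : E →* E) x)⁻¹ = (x : Eˣ) := inv_eq_of_mul_eq_one_left hx
  rw [coe_divConj, Subgroup.coe_mul, div_eq_mul_inv, hinv]

/-- `χ̌|_{E¹} = χ²`. [cite: Liu2021, App. D §D.1, arXiv:2102.11518 p. 56 L18] -/
theorem check_coe (χ : S.normOne →* ℂˣ) (x : S.normOne) : S.check χ (x : Eˣ) = χ x * χ x := by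
  rw [check_apply, divConj_coe, map_mul]

/-! ## §2 The Liu datum over the hardened carriers (feeds the EXISTING record; no new record) -/

section Datum

variable [TopologicalSpace E]
variable {V : Type*} [AddCommGroup V] [Module ℂ V]

open Literature.RepresentationTheory.CentralCharacterQuotient (augmentation quotRep)

/-- **The Liu datum at one place over honest carriers**: `G := U(V)(F)` (with the topology inherited from `E`),
`Z := E¹`, `zeta :=` the scalars, `chi := χ`, `omega := ω` (object-match duty: `ω = ω(μ, ε) = ω(ε) ∘ ι_μ`),
`quot :=` the maximal `χ`-quotient (`CentralCharacterQuotient.quotRep`), `rank := n`.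
[cite: Liu2021, App. D §D.1 Steps 1–3, arXiv p. 56 L12–L16] -/
def datum (ω : Representation ℂ S.U V) (χ : S.normOne →* ℂˣ) :
    LocalOscillatorDatum S.U S.normOne V (V ⧸ augmentation ω S.scalar χ) :=
  LocalOscillatorDatum.ofCentralChar ω S.scalar S.scalar_mem_center χ n S.two_le

variable (ω : Representation ℂ S.U V) (χ : S.normOne →* ℂˣ)

/-- unfolding: `omega = ω`. [cite: Liu2021, App. D §D.1 Steps 1–3, arXiv:2102.11518 p. 56 L12–L16] -/
@[simp] theorem datum_omega : (S.datum ω χ).omega = ω := rfl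
/-- unfolding: `zeta =` the scalars `E¹ ↪ U(V)`. [cite: Liu2021, App. D §D.1 Steps 1–3, arXiv:2102.11518 p. 56 L12–L16] -/
@[simp] theorem datum_zeta : (S.datum ω χ).zeta = S.scalar := rfl
/-- unfolding: `chi = χ`. [cite: Liu2021, App. D §D.1 Steps 1–3, arXiv:2102.11518 p. 56 L12–L16] -/
@[simp] theorem datum_chi : (S.datum ω χ).chi = χ := rfl
/-- unfolding: `rank = n`. [cite: Liu2021, App. D §D.1 Steps 1–3, arXiv:2102.11518 p. 56 L12–L16] -/
@[simp] theorem datum_rank : (S.datum ω χ).rank = n := rfl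
/-- unfolding: `quot =` the maximal `χ`-quotient `quotRep`. [cite: Liu2021, App. D §D.1 Steps 1–3, arXiv:2102.11518 p. 56 L12–L16] -/
@[simp] theorem datum_quot : (S.datum ω χ).quot = quotRep ω S.scalar_mem_center χ := rfl

/-- The cited record [Liu2021, Lemma D.1] of the hardened datum, unfolded (it IS the existing
`LocalOscillatorDatum.IrreducibleAdmissible`; nothing new is recorded). [cite: Liu2021, App. D Lemma D.1
(arXiv:2102.11518 Lemma 10.1), arXiv p. 56] -/
theorem irreducibleAdmissible_datum_iff :
    (S.datum ω χ).IrreducibleAdmissible ↔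
      (quotRep ω S.scalar_mem_center χ).IsAdmissible ∧
        (Nontrivial (V ⧸ augmentation ω S.scalar χ) → (quotRep ω S.scalar_mem_center χ).IsIrreducible) ∧
        (n ≠ 2 → Nontrivial (V ⧸ augmentation ω S.scalar χ)) :=
  Iff.rfl

/-- Consumer form at `n = 3` (the pub-hodgecm cells): from the cited record, `ω(μ, ε, χ)` is irreducible and
admissible. [cite: Liu2021, App. D Lemma D.1, arXiv p. 56] -/
theorem isIrreducible_and_isAdmissible_of_three (S : OscillatorStandingData F E 3) (ω : Representation ℂ S.U V)
    (χ : S.normOne →* ℂˣ) (h : (S.datum ω χ).IrreducibleAdmissible) :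
    (quotRep ω S.scalar_mem_center χ).IsIrreducible ∧ (quotRep ω S.scalar_mem_center χ).IsAdmissible :=
  ⟨h.isIrreducible_of_rank_eq_three rfl, h.isAdmissible⟩

/-- With `E` a topological ring, `U(V)(F)` is a topological group (closed subgroup of `GL_n(E)`); recorded as an
instance check. [folklore] -/
example [IsTopologicalRing E] : IsTopologicalGroup S.U := inferInstance

end Datum

/-- print's `E⁻ = {x ∈ E | x + xᶜ = 0}` as an `F`-submodule of `E` (the home of `ε`, Step 1).
[cite: Liu2021, App. D §D.1, arXiv p. 56 L8] -/
def skew : Submodule F E := LinearMap.ker (LinearMap.id + S.conj.toLinearMap)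

/-- membership in `E⁻`: `x + xᶜ = 0`. [cite: Liu2021, App. D §D.1, arXiv:2102.11518 p. 56 L8] -/
theorem mem_skew_iff (x : E) : x ∈ S.skew ↔ x + S.conj x = 0 := by
  simp [skew]

end OscillatorStandingData

/-! ## §3 The split place `E = F × F`: "We identify `U(V)` with `GL_n(F)` and `E⁻` with `F` through the first
factor … Note that the first component of `χ̌` is simply `χ`" [p0056 L32] -/

namespace SplitPlace

variable (F : Type uF) [Field F]

/-- print's `c` at a split place: the swap `(a, b) ↦ (b, a)` of `E = F × F`, an `F`-algebra involution.
[cite: Liu2021, App. D §D.1, arXiv p. 56 L32] -/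
def swap : (F × F) ≃ₐ[F] (F × F) :=
  AlgEquiv.ofRingEquiv (f := (RingEquiv.prodComm : (F × F) ≃+* (F × F))) fun _ => rfl

/-- `swap (a, b) = (b, a)`. [cite: Liu2021, App. D §D.1 (proof of Lemma D.1, split case), arXiv:2102.11518 p. 56 L32] -/
@[simp] theorem swap_apply (x : F × F) : swap F x = x.swap := rfl

/-- `F × F ≅ F^{Bool}` as `F`-algebras (to read off étaleness from Mathlib's product instance). [folklore] -/
def piBoolAlgEquivProd : (Bool → F) ≃ₐ[F] (F × F) where
  toFun f := (f true, f false)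
  invFun p b := cond b p.1 p.2
  left_inv f := by
    funext b
    cases b <;> rfl
  right_inv _ := rfl
  map_mul' _ _ := rfl
  map_add' _ _ := rfl
  commutes' _ := rfl

/-- `F × F` is (formally) étale over `F`. [folklore] -/
instance formallyEtale_prod : Algebra.FormallyEtale F (F × F) :=
  Algebra.FormallyEtale.of_equiv (piBoolAlgEquivProd F)

/-- `F × F` has rank `2` over `F`. [folklore] -/
private theorem finrank_prod_self : Module.finrank F (F × F) = 2 := by
  rw [Module.finrank_prod, Module.finrank_self]

/-- At a split place `E = F × F` is NOT a field, so the exceptional case of [Liu2021, Lemma D.1 (1)] ("`E` is a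
field, `V` is anisotropic …") never occurs there.
[cite: Liu2021, App. D §D.1, proof of Lemma D.1 ("the case where `E = F × F`" / "Now we assume that `E` is a field"), arXiv:2102.11518 p. 56 L32–L34] -/
theorem not_isField : ¬ IsField (F × F) := fun h => by
  obtain ⟨b, hb⟩ := h.mul_inv_cancel (a := ((1 : F), (0 : F))) (by simp)
  have := congrArg Prod.snd hb
  simp at this

variable {F}
variable {m : Type*}

/-- the two components of a matrix over `F × F`. [folklore] -/
private theorem matrix_eq_iff (M N : Matrix m m (F × F)) :
    M = N ↔ M.map (RingHom.fst F F) = N.map (RingHom.fst F F) ∧ M.map (RingHom.snd F F) = N.map (RingHom.snd F F) := by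
  refine ⟨fun h => by rw [h]; exact ⟨rfl, rfl⟩, fun h => ?_⟩
  ext i j
  · simpa using congrFun (congrFun h.1 i) j
  · simpa using congrFun (congrFun h.2 i) j

/-- `(M^swap)¹ = M²`. [folklore] -/
private theorem map_swap_map_fst (M : Matrix m m (F × F)) :
    (M.map (swap F)).map (RingHom.fst F F) = M.map (RingHom.snd F F) := by
  rw [Matrix.map_map]; rfl

/-- `(M^swap)² = M¹`. [folklore] -/
private theorem map_swap_map_snd (M : Matrix m m (F × F)) :
    (M.map (swap F)).map (RingHom.snd F F) = M.map (RingHom.fst F F) := by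
  rw [Matrix.map_map]; rfl

/-- the matrix over `F × F` with components `(A, B)`. [folklore] -/
def pairMatrix (A B : Matrix m m F) : Matrix m m (F × F) := Matrix.of fun i j => (A i j, B i j)

/-- first component of `pairMatrix A B`. [folklore] -/
@[simp] private theorem pairMatrix_map_fst (A B : Matrix m m F) : (pairMatrix A B).map (RingHom.fst F F) = A := rfl
/-- second component of `pairMatrix A B`. [folklore] -/
@[simp] private theorem pairMatrix_map_snd (A B : Matrix m m F) : (pairMatrix A B).map (RingHom.snd F F) = B := rfl

/-- `M ↦ (M¹, M²)`: matrices over `F × F` are pairs of matrices over `F`. [folklore] -/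
def matrixProdEquiv [Fintype m] : Matrix m m (F × F) ≃+* Matrix m m F × Matrix m m F where
  toFun M := (M.map (RingHom.fst F F), M.map (RingHom.snd F F))
  invFun p := pairMatrix p.1 p.2
  left_inv _ := (matrix_eq_iff _ _).2 ⟨rfl, rfl⟩
  right_inv _ := rfl
  map_mul' _ _ := Prod.ext Matrix.map_mul Matrix.map_mul
  map_add' M N := Prod.ext (Matrix.map_add _ (map_add (RingHom.fst F F)) M N)
    (Matrix.map_add _ (map_add (RingHom.snd F F)) M N)

/-- unfolding of `matrixProdEquiv`. [folklore] -/
@[simp] private theorem matrixProdEquiv_apply [Fintype m] (M : Matrix m m (F × F)) :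
    matrixProdEquiv M = (M.map (RingHom.fst F F), M.map (RingHom.snd F F)) := rfl

/-- `(A, B)` is invertible iff both components are. [folklore] -/
private theorem isUnit_pairMatrix_iff [Fintype m] [DecidableEq m] (A B : Matrix m m F) :
    IsUnit (pairMatrix A B) ↔ IsUnit A ∧ IsUnit B := by
  rw [← isUnit_map_iff (matrixProdEquiv (F := F) (m := m)) (pairMatrix A B), Prod.isUnit_iff,
    matrixProdEquiv_apply, pairMatrix_map_fst, pairMatrix_map_snd]

section Data

variable {n : ℕ} (H₁ : Matrix (Fin n) (Fin n) F) (hH : IsUnit H₁.det) (hn : 2 ≤ n) (h2 : ringChar F ≠ 2)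

/-- **The standing data at a split place**: `E = F × F` with the swap, Gram matrix `(H₁, H₁ᵀ)` for any
`H₁ ∈ GL_n(F)` (a `swap`-hermitian matrix over `F × F` is exactly a pair `(H₁, H₁ᵀ)`), `char F ≠ 2`, `n ≥ 2`;
the étale-of-rank-2 clauses are THEOREMS here (`formallyEtale_prod`, `finrank_prod_self`).
[cite: Liu2021, App. D §D.1, arXiv p. 56 L8, L32] -/
def splitData : OscillatorStandingData F (F × F) n where
  conj := swap F
  conj_conj x := Prod.swap_swap x
  conj_ne_refl h := by
    have := DFunLike.congr_fun h ((1 : F), (0 : F))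
    simp at this
  gram := pairMatrix H₁ H₁ᵀ
  gram_hermitian := by
    refine (matrix_eq_iff _ _).2 ⟨?_, ?_⟩
    · rw [← Matrix.transpose_map, map_swap_map_fst, Matrix.transpose_map, pairMatrix_map_snd, pairMatrix_map_fst,
        transpose_transpose]
    · rw [← Matrix.transpose_map, map_swap_map_snd, Matrix.transpose_map, pairMatrix_map_fst, pairMatrix_map_snd]
  isUnit_det_gram := by
    rw [← Matrix.isUnit_iff_isUnit_det, isUnit_pairMatrix_iff, Matrix.isUnit_transpose, and_self,
      Matrix.isUnit_iff_isUnit_det]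
    exact hH
  ringChar_ne_two := h2
  formallyEtale := formallyEtale_prod F
  finrank_eq_two := finrank_prod_self F
  two_le := hn

/-- unfolding: the involution of the split data is the swap. [cite: Liu2021, App. D §D.1 (proof of Lemma D.1, split case), arXiv:2102.11518 p. 56 L32] -/
@[simp] theorem splitData_conj : (splitData H₁ hH hn h2).conj = swap F := rfl
/-- unfolding: the Gram matrix of the split data is `(H₁, H₁ᵀ)`. [cite: Liu2021, App. D §D.1 (proof of Lemma D.1, split case), arXiv:2102.11518 p. 56 L32] -/
@[simp] theorem splitData_gram : (splitData H₁ hH hn h2).gram = pairMatrix H₁ H₁ᵀ := rfl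

/-! ### `E¹ = Fˣ` through the first factor -/

/-- membership in `E¹` at a split place: `(a, b) ∈ E¹ ↔ a b = 1`. [cite: Liu2021, App. D §D.1 (proof of Lemma D.1, split case), arXiv:2102.11518 p. 56 L32] -/
theorem mem_normOne_iff (x : (F × F)ˣ) :
    x ∈ (splitData H₁ hH hn h2).normOne ↔ (x : F × F).1 * (x : F × F).2 = 1 := by
  rw [OscillatorStandingData.mem_normOne_iff', splitData_conj, swap_apply, Prod.ext_iff]
  simp only [Prod.fst_mul, Prod.snd_mul, Prod.fst_swap, Prod.snd_swap, Prod.fst_one, Prod.snd_one]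
  constructor
  · exact fun h => h.1
  · exact fun h => ⟨h, by rwa [mul_comm]⟩

/-- `(a, a⁻¹) ∈ E¹` for `a ∈ Fˣ`. [folklore] -/
def normOneOfUnit (a : Fˣ) : (splitData H₁ hH hn h2).normOne :=
  ⟨MulEquiv.prodUnits.symm (a, a⁻¹), (mem_normOne_iff H₁ hH hn h2 _).2 (by simp [MulEquiv.prodUnits])⟩

/-- `normOneOfUnit a = (a, a⁻¹)`. [cite: Liu2021, App. D §D.1 (proof of Lemma D.1, split case), arXiv:2102.11518 p. 56 L32] -/
@[simp] theorem coe_normOneOfUnit (a : Fˣ) :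
    (((normOneOfUnit H₁ hH hn h2 a : (splitData H₁ hH hn h2).normOne) : (F × F)ˣ) : F × F) =
      ((a : F), ((a⁻¹ : Fˣ) : F)) :=
  rfl

/-- the first-factor projection `E¹ → Fˣ`. [cite: Liu2021, App. D §D.1, arXiv p. 56 L32] -/
def normOneToUnits : (splitData H₁ hH hn h2).normOne →* Fˣ :=
  (Units.map (RingHom.fst F F : F × F →* F)).comp (splitData H₁ hH hn h2).normOne.subtype

/-- the first-factor projection on `E¹`, on elements. [cite: Liu2021, App. D §D.1 (proof of Lemma D.1, split case), arXiv:2102.11518 p. 56 L32] -/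
@[simp] theorem coe_normOneToUnits (x : (splitData H₁ hH hn h2).normOne) :
    ((normOneToUnits H₁ hH hn h2 x : Fˣ) : F) = (((x : (F × F)ˣ)) : F × F).1 := rfl

/-- `(a, a⁻¹) ↦ a`. [cite: Liu2021, App. D §D.1 (proof of Lemma D.1, split case), arXiv:2102.11518 p. 56 L32] -/
theorem normOneToUnits_normOneOfUnit (a : Fˣ) : normOneToUnits H₁ hH hn h2 (normOneOfUnit H₁ hH hn h2 a) = a :=
  Units.ext rfl

/-- the first-factor projection `E¹ → Fˣ` is bijective. [cite: Liu2021, App. D §D.1 (proof of Lemma D.1, split case), arXiv:2102.11518 p. 56 L32] -/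
theorem normOneToUnits_bijective : Function.Bijective (normOneToUnits H₁ hH hn h2) := by
  refine ⟨fun x y hxy => ?_, fun a => ⟨normOneOfUnit H₁ hH hn h2 a, normOneToUnits_normOneOfUnit H₁ hH hn h2 a⟩⟩
  have h1 : (((x : (F × F)ˣ)) : F × F).1 = (((y : (F × F)ˣ)) : F × F).1 := by
    simpa using congrArg (fun u : Fˣ => (u : F)) hxy
  have hx := (mem_normOne_iff H₁ hH hn h2 _).1 x.2
  have hy := (mem_normOne_iff H₁ hH hn h2 _).1 y.2
  have h2' : (((x : (F × F)ˣ)) : F × F).2 = (((y : (F × F)ˣ)) : F × F).2 := by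
    have hx0 : (((x : (F × F)ˣ)) : F × F).1 ≠ 0 := fun h0 => by simp [h0] at hx
    apply mul_left_cancel₀ hx0
    rw [hx, h1, hy]
  exact Subtype.ext (Units.ext (Prod.ext h1 h2'))

/-- **`E¹ ≃ Fˣ` through the first factor** at a split place, `(a, a⁻¹) ↤ a`.
[cite: Liu2021, App. D §D.1, arXiv p. 56 L32] -/
def normOneEquiv : (splitData H₁ hH hn h2).normOne ≃* Fˣ where
  toFun := normOneToUnits H₁ hH hn h2
  invFun := normOneOfUnit H₁ hH hn h2
  left_inv _ := (normOneToUnits_bijective H₁ hH hn h2).1 (normOneToUnits_normOneOfUnit H₁ hH hn h2 _)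
  right_inv := normOneToUnits_normOneOfUnit H₁ hH hn h2
  map_mul' := map_mul _

/-- unfolding of `normOneEquiv`. [cite: Liu2021, App. D §D.1 (proof of Lemma D.1, split case), arXiv:2102.11518 p. 56 L32] -/
@[simp] theorem normOneEquiv_apply (x : (splitData H₁ hH hn h2).normOne) :
    normOneEquiv H₁ hH hn h2 x = normOneToUnits H₁ hH hn h2 x := rfl

/-- unfolding of `normOneEquiv.symm`: `a ↦ (a, a⁻¹)`. [cite: Liu2021, App. D §D.1 (proof of Lemma D.1, split case), arXiv:2102.11518 p. 56 L32] -/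
@[simp] theorem normOneEquiv_symm_apply (a : Fˣ) :
    (normOneEquiv H₁ hH hn h2).symm a = normOneOfUnit H₁ hH hn h2 a := rfl

/-! ### `U(V) = GL_n(F)` through the first factor -/

/-- membership in `U(V)` at a split place, in components `g = (g¹, g²)`: `(g²)ᵀ H₁ g¹ = H₁`. [cite: Liu2021, App. D §D.1 (proof of Lemma D.1, split case), arXiv:2102.11518 p. 56 L32] -/
theorem mem_U_iff (g : GL (Fin n) (F × F)) :
    g ∈ (splitData H₁ hH hn h2).U ↔
      ((g : Matrix (Fin n) (Fin n) (F × F)).map (RingHom.snd F F))ᵀ * H₁ *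
        (g : Matrix (Fin n) (Fin n) (F × F)).map (RingHom.fst F F) = H₁ := by
  rw [OscillatorStandingData.mem_U_iff, splitData_conj, splitData_gram, matrix_eq_iff]
  simp only [Matrix.map_mul, ← Matrix.transpose_map, map_swap_map_fst, map_swap_map_snd, pairMatrix_map_fst,
    pairMatrix_map_snd]
  constructor
  · exact fun h => h.1
  · intro h
    refine ⟨h, ?_⟩
    have h' := congrArg Matrix.transpose h
    simp only [transpose_mul, ← Matrix.transpose_map, transpose_transpose, Matrix.mul_assoc] at h' ⊢
    exact h'

/-- the first-factor projection `U(V) → GL_n(F)`. [cite: Liu2021, App. D §D.1, arXiv p. 56 L32] -/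
def unitaryToGL : (splitData H₁ hH hn h2).U →* GL (Fin n) F :=
  (Matrix.GeneralLinearGroup.map (RingHom.fst F F)).comp (splitData H₁ hH hn h2).U.subtype

/-- the first-factor projection on `U(V)`, on matrices. [cite: Liu2021, App. D §D.1 (proof of Lemma D.1, split case), arXiv:2102.11518 p. 56 L32] -/
@[simp] theorem coe_unitaryToGL (g : (splitData H₁ hH hn h2).U) :
    ((unitaryToGL H₁ hH hn h2 g : GL (Fin n) F) : Matrix (Fin n) (Fin n) F) =
      ((g : GL (Fin n) (F × F)) : Matrix (Fin n) (Fin n) (F × F)).map (RingHom.fst F F) := rfl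

/-- the second component of `g ∈ U(V)` is determined by the first: `(g²)ᵀ = H₁ (g¹)⁻¹ H₁⁻¹`. [cite: Liu2021, App. D §D.1 (proof of Lemma D.1, split case), arXiv:2102.11518 p. 56 L32] -/
theorem transpose_snd_eq_of_mem {g : GL (Fin n) (F × F)} (hg : g ∈ (splitData H₁ hH hn h2).U) :
    ((g : Matrix (Fin n) (Fin n) (F × F)).map (RingHom.snd F F))ᵀ =
      H₁ * ((g⁻¹ : GL (Fin n) (F × F)) : Matrix (Fin n) (Fin n) (F × F)).map (RingHom.fst F F) * H₁⁻¹ := by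
  have h := (mem_U_iff H₁ hH hn h2 g).1 hg
  have hinv : (g : Matrix (Fin n) (Fin n) (F × F)).map (RingHom.fst F F) *
      ((g⁻¹ : GL (Fin n) (F × F)) : Matrix (Fin n) (Fin n) (F × F)).map (RingHom.fst F F) = 1 := by
    rw [← Matrix.map_mul, ← Units.val_mul, mul_inv_cancel, Units.val_one, Matrix.map_one _ rfl rfl]
  calc ((g : Matrix (Fin n) (Fin n) (F × F)).map (RingHom.snd F F))ᵀ
      = ((g : Matrix (Fin n) (Fin n) (F × F)).map (RingHom.snd F F))ᵀ * H₁ *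
          (g : Matrix (Fin n) (Fin n) (F × F)).map (RingHom.fst F F) *
          (((g⁻¹ : GL (Fin n) (F × F)) : Matrix (Fin n) (Fin n) (F × F)).map (RingHom.fst F F) * H₁⁻¹) := by
        rw [Matrix.mul_assoc, Matrix.mul_assoc, ← Matrix.mul_assoc (((g : GL (Fin n) (F × F)) :
          Matrix (Fin n) (Fin n) (F × F)).map (RingHom.fst F F)), hinv, Matrix.one_mul,
          Matrix.mul_nonsing_inv _ hH, Matrix.mul_one]
    _ = H₁ * ((g⁻¹ : GL (Fin n) (F × F)) : Matrix (Fin n) (Fin n) (F × F)).map (RingHom.fst F F) * H₁⁻¹ := by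
        rw [h, Matrix.mul_assoc]

/-- the first-factor projection `U(V) → GL_n(F)` is injective (the second component is determined). [cite: Liu2021, App. D §D.1 (proof of Lemma D.1, split case), arXiv:2102.11518 p. 56 L32] -/
theorem unitaryToGL_injective : Function.Injective (unitaryToGL H₁ hH hn h2) := by
  intro g g' hgg'
  have h1 : ((g : GL (Fin n) (F × F)) : Matrix (Fin n) (Fin n) (F × F)).map (RingHom.fst F F) =
      ((g' : GL (Fin n) (F × F)) : Matrix (Fin n) (Fin n) (F × F)).map (RingHom.fst F F) := by
    simpa using congrArg (fun u : GL (Fin n) F => (u : Matrix (Fin n) (Fin n) F)) hgg'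
  have h1' : (((g : GL (Fin n) (F × F))⁻¹ : GL (Fin n) (F × F)) : Matrix (Fin n) (Fin n) (F × F)).map
        (RingHom.fst F F) =
      (((g' : GL (Fin n) (F × F))⁻¹ : GL (Fin n) (F × F)) : Matrix (Fin n) (Fin n) (F × F)).map
        (RingHom.fst F F) := by
    have := congrArg (fun u : GL (Fin n) F => ((u⁻¹ : GL (Fin n) F) : Matrix (Fin n) (Fin n) F)) hgg'
    simpa [unitaryToGL, Matrix.GeneralLinearGroup.map] using this
  have h2' : ((g : GL (Fin n) (F × F)) : Matrix (Fin n) (Fin n) (F × F)).map (RingHom.snd F F) =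
      ((g' : GL (Fin n) (F × F)) : Matrix (Fin n) (Fin n) (F × F)).map (RingHom.snd F F) := by
    rw [← transpose_transpose (((g : GL (Fin n) (F × F)) : Matrix (Fin n) (Fin n) (F × F)).map _),
      transpose_snd_eq_of_mem H₁ hH hn h2 g.2, h1', ← transpose_snd_eq_of_mem H₁ hH hn h2 g'.2,
      transpose_transpose]
  exact Subtype.ext (Units.ext ((matrix_eq_iff _ _).2 ⟨h1, h2'⟩))

/-- the partner of `A ∈ GL_n(F)`: the matrix `B` with `Bᵀ H₁ A = H₁`, namely `B = (H₁ A⁻¹ H₁⁻¹)ᵀ`. [folklore] -/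
def partner (A : GL (Fin n) F) : Matrix (Fin n) (Fin n) F :=
  (H₁ * ((A⁻¹ : GL (Fin n) F) : Matrix (Fin n) (Fin n) F) * H₁⁻¹)ᵀ

include hH in
/-- `(partner A)ᵀ H₁ A = H₁`. [folklore] -/
private theorem transpose_partner_mul (A : GL (Fin n) F) :
    (partner H₁ A)ᵀ * H₁ * (A : Matrix (Fin n) (Fin n) F) = H₁ := by
  rw [partner, transpose_transpose, Matrix.mul_assoc (H₁ * _) H₁⁻¹ H₁, Matrix.nonsing_inv_mul _ hH,
    Matrix.mul_one, Matrix.mul_assoc, ← Units.val_mul, inv_mul_cancel, Units.val_one, Matrix.mul_one]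

include hH in
/-- `A ↦ partner A` is multiplicative … [folklore] -/
private theorem partner_mul (A B : GL (Fin n) F) : partner H₁ A * partner H₁ B = partner H₁ (A * B) := by
  rw [partner, partner, partner, ← transpose_mul, _root_.mul_inv_rev, Units.val_mul]
  congr 1
  simp only [Matrix.mul_assoc, Matrix.nonsing_inv_mul_cancel_left H₁ _ hH]

include hH in
/-- … and unital. [folklore] -/
private theorem partner_one : partner H₁ 1 = 1 := by
  rw [partner, inv_one, Units.val_one, Matrix.mul_one, Matrix.mul_nonsing_inv _ hH, transpose_one]

/-- `pairMatrix` is multiplicative. [folklore] -/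
private theorem pairMatrix_mul {k : Type*} [Fintype k] (A B A' B' : Matrix k k F) :
    pairMatrix A B * pairMatrix A' B' = pairMatrix (A * A') (B * B') := by
  rw [matrix_eq_iff]
  simp only [Matrix.map_mul, pairMatrix_map_fst, pairMatrix_map_snd, and_self]

/-- `pairMatrix 1 1 = 1`. [folklore] -/
private theorem pairMatrix_one {k : Type*} [DecidableEq k] : pairMatrix (1 : Matrix k k F) 1 = 1 := by
  rw [matrix_eq_iff, pairMatrix_map_fst, pairMatrix_map_snd, Matrix.map_one _ rfl rfl, Matrix.map_one _ rfl rfl]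
  exact ⟨rfl, rfl⟩

/-- the element of `GL_n(F × F)` over `A ∈ GL_n(F)` with components `(A, (H₁ A⁻¹ H₁⁻¹)ᵀ)`; its inverse has
components `(A⁻¹, (H₁ A H₁⁻¹)ᵀ)`. [folklore] -/
def glOfGL (A : GL (Fin n) F) : GL (Fin n) (F × F) where
  val := pairMatrix (A : Matrix (Fin n) (Fin n) F) (partner H₁ A)
  inv := pairMatrix ((A⁻¹ : GL (Fin n) F) : Matrix (Fin n) (Fin n) F) (partner H₁ A⁻¹)
  val_inv := by
    rw [pairMatrix_mul, ← Units.val_mul, partner_mul H₁ hH, mul_inv_cancel, Units.val_one, partner_one H₁ hH,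
      pairMatrix_one]
  inv_val := by
    rw [pairMatrix_mul, ← Units.val_mul, partner_mul H₁ hH, inv_mul_cancel, Units.val_one, partner_one H₁ hH,
      pairMatrix_one]

/-- the matrix of `glOfGL A` is `(A, (H₁ A⁻¹ H₁⁻¹)ᵀ)`. [cite: Liu2021, App. D §D.1 (proof of Lemma D.1, split case), arXiv:2102.11518 p. 56 L32] -/
@[simp] theorem coe_glOfGL (A : GL (Fin n) F) :
    ((glOfGL H₁ hH A : GL (Fin n) (F × F)) : Matrix (Fin n) (Fin n) (F × F)) =
      pairMatrix (A : Matrix (Fin n) (Fin n) F) (partner H₁ A) := rfl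

/-- the matrix of `(glOfGL A)⁻¹` is `(A⁻¹, (H₁ A H₁⁻¹)ᵀ)`. [cite: Liu2021, App. D §D.1 (proof of Lemma D.1, split case), arXiv:2102.11518 p. 56 L32] -/
@[simp] theorem coe_glOfGL_inv (A : GL (Fin n) F) :
    (((glOfGL H₁ hH A)⁻¹ : GL (Fin n) (F × F)) : Matrix (Fin n) (Fin n) (F × F)) =
      pairMatrix ((A⁻¹ : GL (Fin n) F) : Matrix (Fin n) (Fin n) F) (partner H₁ A⁻¹) := rfl

/-- `glOfGL A ∈ U(V)`. [cite: Liu2021, App. D §D.1 (proof of Lemma D.1, split case), arXiv:2102.11518 p. 56 L32] -/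
theorem glOfGL_mem (A : GL (Fin n) F) : glOfGL H₁ hH A ∈ (splitData H₁ hH hn h2).U := by
  rw [mem_U_iff, coe_glOfGL, pairMatrix_map_fst, pairMatrix_map_snd, transpose_partner_mul H₁ hH]

/-- the element of `U(V)` over `A ∈ GL_n(F)`: `(A, (H₁ A⁻¹ H₁⁻¹)ᵀ)`. [folklore] -/
def unitaryOfGL (A : GL (Fin n) F) : (splitData H₁ hH hn h2).U := ⟨glOfGL H₁ hH A, glOfGL_mem H₁ hH hn h2 A⟩

/-- unfolding of `unitaryOfGL`. [cite: Liu2021, App. D §D.1 (proof of Lemma D.1, split case), arXiv:2102.11518 p. 56 L32] -/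
@[simp] theorem coe_unitaryOfGL (A : GL (Fin n) F) :
    ((unitaryOfGL H₁ hH hn h2 A : (splitData H₁ hH hn h2).U) : GL (Fin n) (F × F)) = glOfGL H₁ hH A := rfl

/-- the first component of `unitaryOfGL A` is `A`. [cite: Liu2021, App. D §D.1 (proof of Lemma D.1, split case), arXiv:2102.11518 p. 56 L32] -/
theorem unitaryToGL_unitaryOfGL (A : GL (Fin n) F) :
    unitaryToGL H₁ hH hn h2 (unitaryOfGL H₁ hH hn h2 A) = A :=
  Units.ext rfl

/-- **`U(V) ≃ GL_n(F)` through the first factor** at a split place ("We identify `U(V)` with `GL_n(F)` …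
through the first factor"), with inverse `A ↦ (A, (H₁ A⁻¹ H₁⁻¹)ᵀ)`. [cite: Liu2021, App. D §D.1, arXiv p. 56 L32] -/
def unitaryEquiv : (splitData H₁ hH hn h2).U ≃* GL (Fin n) F where
  toFun := unitaryToGL H₁ hH hn h2
  invFun := unitaryOfGL H₁ hH hn h2
  left_inv _ := unitaryToGL_injective H₁ hH hn h2 (unitaryToGL_unitaryOfGL H₁ hH hn h2 _)
  right_inv := unitaryToGL_unitaryOfGL H₁ hH hn h2
  map_mul' := map_mul _

/-- unfolding of `unitaryEquiv`. [cite: Liu2021, App. D §D.1 (proof of Lemma D.1, split case), arXiv:2102.11518 p. 56 L32] -/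
@[simp] theorem unitaryEquiv_apply (g : (splitData H₁ hH hn h2).U) :
    unitaryEquiv H₁ hH hn h2 g = unitaryToGL H₁ hH hn h2 g := rfl

/-- unfolding of `unitaryEquiv.symm`: `A ↦ (A, (H₁ A⁻¹ H₁⁻¹)ᵀ)`. [cite: Liu2021, App. D §D.1 (proof of Lemma D.1, split case), arXiv:2102.11518 p. 56 L32] -/
@[simp] theorem unitaryEquiv_symm_apply (A : GL (Fin n) F) :
    (unitaryEquiv H₁ hH hn h2).symm A = unitaryOfGL H₁ hH hn h2 A := rfl

/-- the first-factor projection `U(V) → GL_n(F)` is bijective. [cite: Liu2021, App. D §D.1 (proof of Lemma D.1, split case), arXiv:2102.11518 p. 56 L32] -/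
theorem unitaryToGL_bijective : Function.Bijective (unitaryToGL H₁ hH hn h2) :=
  (unitaryEquiv H₁ hH hn h2).bijective

/-- Under the two identifications the centre `E¹ ↪ U(V)` becomes the scalars `Fˣ ↪ GL_n(F)`, `a ↦ a · 1`.
[cite: Liu2021, App. D §D.1, arXiv p. 56 L32] -/
theorem unitaryEquiv_scalar (x : (splitData H₁ hH hn h2).normOne) :
    unitaryEquiv H₁ hH hn h2 ((splitData H₁ hH hn h2).scalar x) =
      OscillatorStandingData.unitScalar n (normOneEquiv H₁ hH hn h2 x) := by
  apply Units.ext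
  rw [unitaryEquiv_apply, coe_unitaryToGL, OscillatorStandingData.coe_scalar,
    OscillatorStandingData.coe_unitScalar, Matrix.scalar_apply, Matrix.scalar_apply,
    diagonal_map (map_zero _)]
  rfl

/-! ### "the first component of `χ̌` is simply `χ`" -/

/-- `x / xᶜ` at a split place: `(a, 1) ↦ (a, a⁻¹)`. [cite: Liu2021, App. D §D.1 (proof of Lemma D.1, split case), arXiv:2102.11518 p. 56 L32] -/
theorem divConj_inl (a : Fˣ) :
    (splitData H₁ hH hn h2).divConj (MulEquiv.prodUnits.symm (a, 1)) = normOneOfUnit H₁ hH hn h2 a := by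
  apply Subtype.ext
  rw [OscillatorStandingData.coe_divConj, div_eq_iff_eq_mul]
  apply Units.ext
  simp [MulEquiv.prodUnits, OscillatorStandingData.σ, coe_normOneOfUnit]

/-- **"Note that the first component of `χ̌` is simply `χ`"**: on `Fˣ × {1} ⊂ E^× = Fˣ × Fˣ`,
`χ̌(a, 1) = χ(a, a⁻¹) = (χ ∘ normOneEquiv⁻¹)(a)`. [cite: Liu2021, App. D §D.1, arXiv p. 56 L32] -/
theorem check_inl (χ : (splitData H₁ hH hn h2).normOne →* ℂˣ) (a : Fˣ) :
    (splitData H₁ hH hn h2).check χ (MulEquiv.prodUnits.symm (a, 1)) = χ ((normOneEquiv H₁ hH hn h2).symm a) := by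
  rw [OscillatorStandingData.check_apply, divConj_inl, normOneEquiv_symm_apply]

/-! ### `E⁻ = F` through the first factor -/

/-- membership in `E⁻` at a split place: `(a, b) ∈ E⁻ ↔ b = -a`. [cite: Liu2021, App. D §D.1 (proof of Lemma D.1, split case), arXiv:2102.11518 p. 56 L32] -/
theorem mem_skew_iff (x : F × F) : x ∈ (splitData H₁ hH hn h2).skew ↔ x.2 = -x.1 := by
  rw [OscillatorStandingData.mem_skew_iff, splitData_conj, swap_apply, Prod.ext_iff]
  simp only [Prod.fst_add, Prod.snd_add, Prod.fst_swap, Prod.snd_swap, Prod.fst_zero, Prod.snd_zero]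
  constructor
  · exact fun h => eq_neg_of_add_eq_zero_right h.1
  · intro h
    rw [h, add_neg_cancel, neg_add_cancel]
    exact ⟨rfl, rfl⟩

/-- **`E⁻ ≃ F` through the first factor** ("identify … `E⁻` with `F` through the first factor").
[cite: Liu2021, App. D §D.1, arXiv p. 56 L32] -/
def skewEquiv : (splitData H₁ hH hn h2).skew ≃ₗ[F] F where
  toFun x := (x : F × F).1
  invFun a := ⟨(a, -a), (mem_skew_iff H₁ hH hn h2 _).2 rfl⟩
  left_inv x := by
    apply Subtype.ext
    exact Prod.ext rfl ((mem_skew_iff H₁ hH hn h2 _).1 x.2).symm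
  right_inv _ := rfl
  map_add' _ _ := rfl
  map_smul' _ _ := rfl

/-- unfolding of `skewEquiv`. [cite: Liu2021, App. D §D.1 (proof of Lemma D.1, split case), arXiv:2102.11518 p. 56 L32] -/
@[simp] theorem skewEquiv_apply (x : (splitData H₁ hH hn h2).skew) : skewEquiv H₁ hH hn h2 x = (x : F × F).1 :=
  rfl

/-! ### The identification `U(V) = GL_n(F)` is topological -/

section Topology

variable [TopologicalSpace F]

omit [Field F] in
/-- `x ↦ (f x, g x)` is continuous into matrices over `F × F`. [folklore] -/
private theorem continuous_pairMatrix {k : Type*} {X : Type*} [TopologicalSpace X] {f g : X → Matrix k k F}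
    (hf : Continuous f) (hg : Continuous g) : Continuous fun x => pairMatrix (f x) (g x) :=
  continuous_matrix fun i j => (hf.matrix_elem i j).prodMk (hg.matrix_elem i j)

/-- the first-factor projection `U(V) → GL_n(F)` is continuous. [cite: Liu2021, App. D §D.1 (proof of Lemma D.1, split case), arXiv:2102.11518 p. 56 L32] -/
theorem continuous_unitaryToGL : Continuous (unitaryToGL H₁ hH hn h2) := by
  refine Continuous.comp (g := ⇑(Matrix.GeneralLinearGroup.map (n := Fin n) (RingHom.fst F F))) ?_
    continuous_subtype_val
  refine Continuous.units_map _ ?_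
  exact (continuous_id.matrix_map continuous_fst :
    Continuous fun M : Matrix (Fin n) (Fin n) (F × F) => M.map (RingHom.fst F F))

variable [IsTopologicalRing F]

/-- `A ↦ (H₁ A⁻¹ H₁⁻¹)ᵀ` is continuous on `GL_n(F)`. [folklore] -/
private theorem continuous_partner : Continuous (partner H₁) := by
  change Continuous fun A : GL (Fin n) F => (H₁ * ((A⁻¹ : GL (Fin n) F) : Matrix (Fin n) (Fin n) F) * H₁⁻¹)ᵀ
  exact ((continuous_const.matrix_mul Units.continuous_coe_inv).matrix_mul continuous_const).matrix_transpose

/-- its inverse `GL_n(F) → U(V)` is continuous. [cite: Liu2021, App. D §D.1 (proof of Lemma D.1, split case), arXiv:2102.11518 p. 56 L32] -/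
theorem continuous_unitaryOfGL : Continuous (unitaryOfGL H₁ hH hn h2) := by
  refine Continuous.subtype_mk ?_ _
  refine Units.continuous_iff.2 ⟨?_, ?_⟩
  · exact continuous_pairMatrix Units.continuous_val (continuous_partner H₁)
  · exact continuous_pairMatrix Units.continuous_coe_inv ((continuous_partner H₁).comp continuous_inv)

/-- **`U(V) ≅ GL_n(F)` as TOPOLOGICAL groups** at a split place (so, e.g., compact open subgroups and smooth /
admissible representations correspond). [cite: Liu2021, App. D §D.1, arXiv p. 56 L32] -/
def unitaryContinuousEquiv : (splitData H₁ hH hn h2).U ≃ₜ* GL (Fin n) F :=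
  { unitaryEquiv H₁ hH hn h2 with
    continuous_toFun := continuous_unitaryToGL H₁ hH hn h2
    continuous_invFun := continuous_unitaryOfGL H₁ hH hn h2 }

/-- unfolding of `unitaryContinuousEquiv`. [cite: Liu2021, App. D §D.1 (proof of Lemma D.1, split case), arXiv:2102.11518 p. 56 L32] -/
@[simp] theorem unitaryContinuousEquiv_apply (g : (splitData H₁ hH hn h2).U) :
    unitaryContinuousEquiv H₁ hH hn h2 g = unitaryToGL H₁ hH hn h2 g := rfl

end Topology

end Data

/-- Non-vacuity of the hardened standing data at the cells' rank `n = 3`: the split place over `ℚ` (any field of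
characteristic `≠ 2` would do) with the standard form `H₁ = 1`. [folklore] -/
example : OscillatorStandingData ℚ (ℚ × ℚ) 3 :=
  splitData (1 : Matrix (Fin 3) (Fin 3) ℚ) (by simp) (by norm_num) (by rw [ringChar.eq_zero]; norm_num)

end SplitPlace

end Literature.RepresentationTheory.Liu2021
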